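import Summits.RiemannHypothesis.RiemannHypothesis.Theorems.TiltedLandingLaw421R3Hurwitz
import Summits.RiemannHypothesis.RiemannHypothesis.Theorems.TiltedLandingLaw421R3BotQ
import Summits.RiemannHypothesis.RiemannHypothesis.Theorems.TiltedLandingLaw421R3WindowLoss

/-! # TiltedLandingLaw421R3Dimple
SUPPORT module for crux `TiltedLandingLaw421` (stmt-RiemannHypothesis-24774), `--supports … --as helper` only: proves no stub, no crux; fully proved
(0 sorry, no `instance`, no `notation`). W-08 ROUND-3b, C3 «analysis» rh-idea-3 g35 (folder kernel `LandingIVT-W08-C3-rh-idea-3-g35.lean`); it is the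
`DimpleSig` piece of C1 rh-idea-5 g25's three-piece composition `restSuccBotQ_of_pieces : ClusterStepSig → DimpleSig → AntiEscape → RestSuccBotQ`
(WORDS-66 ADD-7, sketch 4d142afb).

THE DIMPLE LEMMA. If on a real interval `[α, β]` free of zeros of `F_k = f⁽ᵏ⁾` (f entire, `F_k` real on `ℝ`) the product `Re F_{k+1} · Re F_k` is `< 0`
at `α` and `> 0` at `β`, then the last non-positive point `c` of `φ = Re F_k · Re F_{k+1}` on `[α, β]` is an UP-CROSSING: `F_{k+1}(c) = 0`, `F_k(c) ≠ 0`,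
`Re F_k(c) · Re F_{k+2}(c) = φ′(c) ≥ 0` — an `NLEventOf f k c` with `c ∈ (α, β)` (`nlEventOf_of_dimple`; core `exists_zero_deriv_nonneg_of_lt`, patterned on
`RhW08.Hurwitz.exists_zero_deriv_nonneg`). Inside the LAW's range this is `TiltReady`/`ReadyR2` at level `k` (`tiltReady_of_dimple`, `readyR2_of_dimple`),
and for a BAND state `v` (`StTrkDQ … k v`) with shadow `[v.re − v.im, v.re + v.im]` the range is automatic (`readyR2_of_dimple_state`, via
`RhW08.QuadW.abs_re_sub_le_of_stTrkDQ` + `band_radius_lt_range'`). Also: the three-sign patterns `+ − +` / `− + −` (`nlEventOf_of_three_signs`, `…'`, IVT twice +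
`RhW08.Hurwitz.nlEventOf_of_two_crit`), tooth-anchored variants (`nlEventOf_right_of_tooth`, `nlEventOf_left_of_tooth`: next to a real zero of `F_k` the outer
sign is supplied by the MVT on `(Re F_k)²`), and the reading lemmas for the pair term `2(x − a)/((x − a)² + b²)` of `F_{k+1}/F_k` on `ℝ` (`pair_term_at_edges`:
`±1/b` at `a ± b`; `pair_term_abs_le`: `≤ 1/b`): for a pair `a + ib` with tooth-free shadow, external edge fields `Γ(a − b) < 1/b ∧ Γ(a + b) > −1/b` give the
dimple signs — the pair LANDS with an NL-event at its own level. K = kernel-checked lemmas about real entire functions; nothing here is about ζ/Ξ.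
Typed ≠ proved; RH is not proved; 24774 OPEN. -/

namespace RhIdea3.G35.Landing

open Set Complex Filter Topology
open RhIdea6.G17.W07C7 RhW08.Hurwitz RhW08.StSwap

/-- continuity of `x ↦ Re f^{(n)}(x)` along the real axis for an entire `f`. -/
theorem continuous_re_iteratedDeriv {f : ℂ → ℂ} (hf : Differentiable ℂ f) (n : ℕ) :
    Continuous fun x : ℝ => (iteratedDeriv n f (x : ℂ)).re := by
  have hdn : Differentiable ℂ (iteratedDeriv n f) :=
    (hf.contDiff (n := ⊤)).differentiable_iteratedDeriv n (WithTop.coe_lt_top _)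
  exact Complex.continuous_re.comp (hdn.continuous.comp Complex.continuous_ofReal)

/-- ★ (K) THREE-SIGN LANDING: on a real interval `[x₂, x₁]` without zeros of `F_k`, the sign pattern `+ − +` of `Re F_{k+1} · Re F_k` at
`x₂ < xm < x₁` forces an NL-event of level `k` inside `[x₂, x₁]`. -/
theorem nlEventOf_of_three_signs {f : ℂ → ℂ} (hf : Differentiable ℂ f) (k : ℕ)
    (hreal : ∀ x : ℝ, (iteratedDeriv k f (x : ℂ)).im = 0)
    {x₂ xm x₁ : ℝ} (h₂ : x₂ < xm) (h₁ : xm < x₁)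
    (hnz : ∀ x ∈ Icc x₂ x₁, iteratedDeriv k f (x : ℂ) ≠ 0)
    (hs₂ : 0 < (iteratedDeriv (k + 1) f (x₂ : ℂ)).re * (iteratedDeriv k f (x₂ : ℂ)).re)
    (hsm : (iteratedDeriv (k + 1) f (xm : ℂ)).re * (iteratedDeriv k f (xm : ℂ)).re < 0)
    (hs₁ : 0 < (iteratedDeriv (k + 1) f (x₁ : ℂ)).re * (iteratedDeriv k f (x₁ : ℂ)).re) :
    ∃ c ∈ Icc x₂ x₁, NLEventOf f k c := by
  set φ : ℝ → ℝ := fun x => (iteratedDeriv (k + 1) f (x : ℂ)).re * (iteratedDeriv k f (x : ℂ)).re with hφ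
  have hφc : Continuous φ := (continuous_re_iteratedDeriv hf (k + 1)).mul (continuous_re_iteratedDeriv hf k)
  -- first zero c₂ ∈ (x₂, xm): φ decreases through 0
  obtain ⟨c₂, hc₂, hφ₂⟩ : ∃ c ∈ Ioo x₂ xm, φ c = 0 := by
    have h := intermediate_value_Ioo' h₂.le hφc.continuousOn (show (0 : ℝ) ∈ Ioo (φ xm) (φ x₂) from ⟨hsm, hs₂⟩)
    obtain ⟨c, hc, hcv⟩ := h
    exact ⟨c, hc, hcv⟩
  -- second zero c₁ ∈ (xm, x₁): φ increases through 0
  obtain ⟨c₁, hc₁, hφ₁⟩ : ∃ c ∈ Ioo xm x₁, φ c = 0 := by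
    have h := intermediate_value_Ioo h₁.le hφc.continuousOn (show (0 : ℝ) ∈ Ioo (φ xm) (φ x₁) from ⟨hsm, hs₁⟩)
    obtain ⟨c, hc, hcv⟩ := h
    exact ⟨c, hc, hcv⟩
  have hlt : c₂ < c₁ := hc₂.2.trans hc₁.1
  have hsub : Icc c₂ c₁ ⊆ Icc x₂ x₁ := Icc_subset_Icc hc₂.1.le hc₁.2.le
  have hre_ne : ∀ x ∈ Icc x₂ x₁, (iteratedDeriv k f (x : ℂ)).re ≠ 0 := fun x hx =>
    RhW08.WindowLoss.re_ne_zero_of_ne_zero (hreal x) (hnz x hx)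
  have hz₂ : (iteratedDeriv (k + 1) f (c₂ : ℂ)).re = 0 := by
    rcases mul_eq_zero.mp hφ₂ with h | h
    · exact h
    · exact absurd h (hre_ne c₂ ⟨hc₂.1.le, (hc₂.2.trans h₁).le⟩)
  have hz₁ : (iteratedDeriv (k + 1) f (c₁ : ℂ)).re = 0 := by
    rcases mul_eq_zero.mp hφ₁ with h | h
    · exact h
    · exact absurd h (hre_ne c₁ ⟨(h₂.trans hc₁.1).le, hc₁.2.le⟩)
  obtain ⟨c, hc, hNL⟩ := nlEventOf_of_two_crit hf k hlt hz₂ hz₁ (fun x hx => hre_ne x (hsub hx))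
  exact ⟨c, hsub hc, hNL⟩

/-- derivative of `x ↦ Re f^{(k)}(x)` along the real axis is `Re f^{(k+1)}(x)`. -/
theorem hasDerivAt_re_iteratedDeriv {f : ℂ → ℂ} (hf : Differentiable ℂ f) (k : ℕ) (t : ℝ) :
    HasDerivAt (fun x : ℝ => (iteratedDeriv k f (x : ℂ)).re) ((iteratedDeriv (k + 1) f (t : ℂ)).re) t := by
  have hdk : Differentiable ℂ (iteratedDeriv k f) :=
    (hf.contDiff (n := ⊤)).differentiable_iteratedDeriv k (WithTop.coe_lt_top _)
  have h := ((hdk (t : ℂ)).hasDerivAt).real_of_complex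
  rw [iteratedDeriv_succ]
  exact h

/-- (K) just right of a real zero `ζ` of `F_k` the product `Re F_{k+1} · Re F_k` is positive somewhere before any point `xm > ζ` where `F_k ≠ 0`
(mean value theorem for `(Re F_k)²` on `[ζ, xm]`) — discharges the left `+` of the three-sign pattern from the nearest tooth. -/
theorem exists_pos_right_of_tooth {f : ℂ → ℂ} (hf : Differentiable ℂ f) (k : ℕ)
    (hreal : ∀ x : ℝ, (iteratedDeriv k f (x : ℂ)).im = 0)
    {ζ xm : ℝ} (hζ : ζ < xm) (hz : iteratedDeriv k f (ζ : ℂ) = 0) (hm : iteratedDeriv k f (xm : ℂ) ≠ 0) :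
    ∃ x₂ ∈ Ioo ζ xm, 0 < (iteratedDeriv (k + 1) f (x₂ : ℂ)).re * (iteratedDeriv k f (x₂ : ℂ)).re := by
  set u : ℝ → ℝ := fun x => (iteratedDeriv k f (x : ℂ)).re with hu
  set u' : ℝ → ℝ := fun x => (iteratedDeriv (k + 1) f (x : ℂ)).re with hu'
  have hd : ∀ x ∈ Ioo ζ xm, HasDerivAt (fun y => u y * u y) (u' x * u x + u x * u' x) x := fun x _ =>
    (hasDerivAt_re_iteratedDeriv hf k x).mul (hasDerivAt_re_iteratedDeriv hf k x)
  have hc : ContinuousOn (fun y => u y * u y) (Icc ζ xm) :=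
    ((continuous_re_iteratedDeriv hf k).mul (continuous_re_iteratedDeriv hf k)).continuousOn
  obtain ⟨c, hc, hslope⟩ := exists_hasDerivAt_eq_slope (fun y => u y * u y) (fun x => u' x * u x + u x * u' x) hζ hc hd
  refine ⟨c, hc, ?_⟩
  have huζ : u ζ = 0 := by simp [hu, hz]
  have hum : u xm ≠ 0 := RhW08.WindowLoss.re_ne_zero_of_ne_zero (hreal xm) hm
  have hpos : 0 < (u xm * u xm - u ζ * u ζ) / (xm - ζ) := by
    rw [huζ, mul_zero, sub_zero]
    exact div_pos (mul_self_pos.mpr hum) (sub_pos.mpr hζ)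
  have h2 : u' c * u c + u c * u' c = 2 * (u' c * u c) := by ring
  have : 0 < 2 * (u' c * u c) := by rw [← h2, hslope]; exact hpos
  simpa [hu, hu'] using (pos_of_mul_pos_right this (by norm_num : (0:ℝ) ≤ 2))

/-- (K) mirror: just left of a real zero `ζ` of `F_k` the product is negative somewhere after any `xm < ζ` with `F_k(xm) ≠ 0`. -/
theorem exists_neg_left_of_tooth {f : ℂ → ℂ} (hf : Differentiable ℂ f) (k : ℕ)
    (hreal : ∀ x : ℝ, (iteratedDeriv k f (x : ℂ)).im = 0)
    {xm ζ : ℝ} (hζ : xm < ζ) (hz : iteratedDeriv k f (ζ : ℂ) = 0) (hm : iteratedDeriv k f (xm : ℂ) ≠ 0) :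
    ∃ x₁ ∈ Ioo xm ζ, (iteratedDeriv (k + 1) f (x₁ : ℂ)).re * (iteratedDeriv k f (x₁ : ℂ)).re < 0 := by
  set u : ℝ → ℝ := fun x => (iteratedDeriv k f (x : ℂ)).re with hu
  set u' : ℝ → ℝ := fun x => (iteratedDeriv (k + 1) f (x : ℂ)).re with hu'
  have hd : ∀ x ∈ Ioo xm ζ, HasDerivAt (fun y => u y * u y) (u' x * u x + u x * u' x) x := fun x _ =>
    (hasDerivAt_re_iteratedDeriv hf k x).mul (hasDerivAt_re_iteratedDeriv hf k x)
  have hc : ContinuousOn (fun y => u y * u y) (Icc xm ζ) :=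
    ((continuous_re_iteratedDeriv hf k).mul (continuous_re_iteratedDeriv hf k)).continuousOn
  obtain ⟨c, hc, hslope⟩ := exists_hasDerivAt_eq_slope (fun y => u y * u y) (fun x => u' x * u x + u x * u' x) hζ hc hd
  refine ⟨c, hc, ?_⟩
  have huζ : u ζ = 0 := by simp [hu, hz]
  have hum : u xm ≠ 0 := RhW08.WindowLoss.re_ne_zero_of_ne_zero (hreal xm) hm
  have hneg : (u ζ * u ζ - u xm * u xm) / (ζ - xm) < 0 := by
    rw [huζ, mul_zero, zero_sub]
    exact div_neg_of_neg_of_pos (neg_neg_of_pos (mul_self_pos.mpr hum)) (sub_pos.mpr hζ)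
  have h2 : u' c * u c + u c * u' c = 2 * (u' c * u c) := by ring
  have : 2 * (u' c * u c) < 0 := by rw [← h2, hslope]; exact hneg
  have : u' c * u c < 0 := by nlinarith
  simpa [hu, hu'] using this

/-- ★★ (K) DIMPLE UNDER A WEAK-EDGE PAIR, tooth-anchored form: let `ζ` be a real zero of `F_k` and `ζ < xm < x₁` with `F_k ≠ 0` on `(ζ, x₁]`;
if `Re F_{k+1}·Re F_k < 0` at `xm` and `> 0` at `x₁` then `F_k` has an NL-event in `(ζ, x₁]`. READING: for a pair `a + ib` of `F_k` in the
tooth-free gap right of `ζ` take `xm = a − b`, `x₁ = a + b`: the hypotheses say `Γ(a − b) < 1/b` and `Γ(a + b) > −1/b` (the external field does not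
overpower the pair's own edge field); conclusion: a non-Laguerre event between the tooth and the pair's disc — `TiltReady` at level `k` if in range.
So on a NEG frame EVERY in-range pair at EVERY level `≤ K` sits in a one-sided edge field `≥ 1/b` (memo §5.4). -/
theorem nlEventOf_right_of_tooth {f : ℂ → ℂ} (hf : Differentiable ℂ f) (k : ℕ)
    (hreal : ∀ x : ℝ, (iteratedDeriv k f (x : ℂ)).im = 0)
    {ζ xm x₁ : ℝ} (hζ : ζ < xm) (h₁ : xm < x₁) (hz : iteratedDeriv k f (ζ : ℂ) = 0)
    (hnz : ∀ x ∈ Ioc ζ x₁, iteratedDeriv k f (x : ℂ) ≠ 0)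
    (hsm : (iteratedDeriv (k + 1) f (xm : ℂ)).re * (iteratedDeriv k f (xm : ℂ)).re < 0)
    (hs₁ : 0 < (iteratedDeriv (k + 1) f (x₁ : ℂ)).re * (iteratedDeriv k f (x₁ : ℂ)).re) :
    ∃ c ∈ Ioc ζ x₁, NLEventOf f k c := by
  obtain ⟨x₂, hx₂, hs₂⟩ := exists_pos_right_of_tooth hf k hreal hζ hz (hnz xm ⟨hζ, h₁.le⟩)
  have hnz' : ∀ x ∈ Icc x₂ x₁, iteratedDeriv k f (x : ℂ) ≠ 0 := fun x hx => hnz x ⟨hx₂.1.trans_le hx.1, hx.2⟩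
  obtain ⟨c, hc, hNL⟩ := nlEventOf_of_three_signs hf k hreal hx₂.2 h₁ hnz' hs₂ hsm hs₁
  exact ⟨c, ⟨hx₂.1.trans_le hc.1, hc.2⟩, hNL⟩

/-- (K) THREE-SIGN LANDING, mirrored pattern `− + −`. -/
theorem nlEventOf_of_three_signs' {f : ℂ → ℂ} (hf : Differentiable ℂ f) (k : ℕ)
    (hreal : ∀ x : ℝ, (iteratedDeriv k f (x : ℂ)).im = 0)
    {x₂ xm x₁ : ℝ} (h₂ : x₂ < xm) (h₁ : xm < x₁)
    (hnz : ∀ x ∈ Icc x₂ x₁, iteratedDeriv k f (x : ℂ) ≠ 0)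
    (hs₂ : (iteratedDeriv (k + 1) f (x₂ : ℂ)).re * (iteratedDeriv k f (x₂ : ℂ)).re < 0)
    (hsm : 0 < (iteratedDeriv (k + 1) f (xm : ℂ)).re * (iteratedDeriv k f (xm : ℂ)).re)
    (hs₁ : (iteratedDeriv (k + 1) f (x₁ : ℂ)).re * (iteratedDeriv k f (x₁ : ℂ)).re < 0) :
    ∃ c ∈ Icc x₂ x₁, NLEventOf f k c := by
  set φ : ℝ → ℝ := fun x => (iteratedDeriv (k + 1) f (x : ℂ)).re * (iteratedDeriv k f (x : ℂ)).re with hφ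
  have hφc : Continuous φ := (continuous_re_iteratedDeriv hf (k + 1)).mul (continuous_re_iteratedDeriv hf k)
  obtain ⟨c₂, hc₂, hφ₂⟩ : ∃ c ∈ Ioo x₂ xm, φ c = 0 := by
    obtain ⟨c, hc, hcv⟩ := intermediate_value_Ioo h₂.le hφc.continuousOn (show (0 : ℝ) ∈ Ioo (φ x₂) (φ xm) from ⟨hs₂, hsm⟩)
    exact ⟨c, hc, hcv⟩
  obtain ⟨c₁, hc₁, hφ₁⟩ : ∃ c ∈ Ioo xm x₁, φ c = 0 := by
    obtain ⟨c, hc, hcv⟩ := intermediate_value_Ioo' h₁.le hφc.continuousOn (show (0 : ℝ) ∈ Ioo (φ x₁) (φ xm) from ⟨hs₁, hsm⟩)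
    exact ⟨c, hc, hcv⟩
  have hlt : c₂ < c₁ := hc₂.2.trans hc₁.1
  have hsub : Icc c₂ c₁ ⊆ Icc x₂ x₁ := Icc_subset_Icc hc₂.1.le hc₁.2.le
  have hre_ne : ∀ x ∈ Icc x₂ x₁, (iteratedDeriv k f (x : ℂ)).re ≠ 0 := fun x hx =>
    RhW08.WindowLoss.re_ne_zero_of_ne_zero (hreal x) (hnz x hx)
  have hz₂ : (iteratedDeriv (k + 1) f (c₂ : ℂ)).re = 0 := by
    rcases mul_eq_zero.mp hφ₂ with h | h
    · exact h
    · exact absurd h (hre_ne c₂ ⟨hc₂.1.le, (hc₂.2.trans h₁).le⟩)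
  have hz₁ : (iteratedDeriv (k + 1) f (c₁ : ℂ)).re = 0 := by
    rcases mul_eq_zero.mp hφ₁ with h | h
    · exact h
    · exact absurd h (hre_ne c₁ ⟨(h₂.trans hc₁.1).le, hc₁.2.le⟩)
  obtain ⟨c, hc, hNL⟩ := nlEventOf_of_two_crit hf k hlt hz₂ hz₁ (fun x hx => hre_ne x (hsub hx))
  exact ⟨c, hsub hc, hNL⟩

/-- ★★ (K) mirror of the dimple lemma: tooth `ζ` on the RIGHT, `x₂ < xm < ζ`, `F_k ≠ 0` on `[x₂, ζ)`, product `< 0` at `x₂` (= `Γ(a − b) < 1/b` with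
`x₂ = a − b`) and `> 0` at `xm` (= `Γ(a + b) > −1/b` with `xm = a + b`): an NL-event in `[x₂, ζ)`. -/
theorem nlEventOf_left_of_tooth {f : ℂ → ℂ} (hf : Differentiable ℂ f) (k : ℕ)
    (hreal : ∀ x : ℝ, (iteratedDeriv k f (x : ℂ)).im = 0)
    {x₂ xm ζ : ℝ} (h₂ : x₂ < xm) (hζ : xm < ζ) (hz : iteratedDeriv k f (ζ : ℂ) = 0)
    (hnz : ∀ x ∈ Ico x₂ ζ, iteratedDeriv k f (x : ℂ) ≠ 0)
    (hs₂ : (iteratedDeriv (k + 1) f (x₂ : ℂ)).re * (iteratedDeriv k f (x₂ : ℂ)).re < 0)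
    (hsm : 0 < (iteratedDeriv (k + 1) f (xm : ℂ)).re * (iteratedDeriv k f (xm : ℂ)).re) :
    ∃ c ∈ Ico x₂ ζ, NLEventOf f k c := by
  obtain ⟨x₁, hx₁, hs₁⟩ := exists_neg_left_of_tooth hf k hreal hζ hz (hnz xm ⟨h₂.le, hζ⟩)
  have hnz' : ∀ x ∈ Icc x₂ x₁, iteratedDeriv k f (x : ℂ) ≠ 0 := fun x hx => hnz x ⟨hx.1, hx.2.trans_lt hx₁.2⟩
  obtain ⟨c, hc, hNL⟩ := nlEventOf_of_three_signs' hf k hreal h₂ hx₁.1 hnz' hs₂ hsm hs₁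
  exact ⟨c, ⟨hc.1, hc.2.trans_lt hx₁.2⟩, hNL⟩

/-! ## The clean DIMPLE LEMMA (no tooth needed): `Re F_{k+1}·Re F_k < 0` at `α`, `> 0` at `β`, `F_k ≠ 0` on `[α, β]` ⟹ NL-event in `(α, β)`.
Mechanism: `(Re F_k)²` decreases at `α` and increases at `β`, so its LAST non-positive point `c` of `Re F_k·Re F_{k+1}` in `[α, β]` is an up-crossing:
`F_{k+1}(c) = 0` and `d/dx (F_k F_{k+1}) (c) = F_{k+1}(c)² + F_k F_{k+2}(c) = F_k F_{k+2}(c) ≥ 0` — a non-Laguerre point. For a pair `a + ib` with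
tooth-free shadow `[a − b, a + b]` the hypotheses read `Γ(a − b) < 1/b ∧ Γ(a + b) > −1/b`: THE EXTERNAL FIELD AT THE DISC EDGES DOES NOT OVERPOWER THE
PAIR'S OWN EDGE FIELD ⟹ an NL-event sits under the pair, at its own level (the real-axis dimple of `|F_k|` below a low / weak-field pair). -/

/-- (H0⁺) up-crossing core: a differentiable `φ` with `φ α < 0 < φ β`, `α < β`, has a zero `c ∈ (α, β)` with `0 ≤ φ′ c`
(same last-point argument as the tree's `RhW08.Hurwitz.exists_zero_deriv_nonneg`). -/
theorem exists_zero_deriv_nonneg_of_lt {φ : ℝ → ℝ} (hφ : Differentiable ℝ φ) {α β : ℝ} (hlt : α < β)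
    (hα : φ α < 0) (hβ : 0 < φ β) : ∃ c ∈ Ioo α β, φ c = 0 ∧ 0 ≤ deriv φ c := by
  set S : Set ℝ := Icc α β ∩ {x | φ x ≤ 0} with hS
  have hSne : S.Nonempty := ⟨α, ⟨left_mem_Icc.mpr hlt.le, hα.le⟩⟩
  have hSbdd : BddAbove S := ⟨β, fun x hx => hx.1.2⟩
  have hScl : IsClosed S := isClosed_Icc.inter (isClosed_le hφ.continuous continuous_const)
  set c := sSup S with hc
  have hcS : c ∈ S := hScl.csSup_mem hSne hSbdd
  have hφc_le : φ c ≤ 0 := hcS.2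
  have hcβ : c < β := lt_of_le_of_ne hcS.1.2 fun h => by
    rw [h] at hφc_le
    exact absurd hφc_le (not_le.mpr hβ)
  have hafter : ∀ y, c < y → y ≤ β → 0 < φ y := fun y hy hy' => by
    by_contra hle
    push Not at hle
    have hyS : y ∈ S := ⟨⟨le_trans hcS.1.1 hy.le, hy'⟩, hle⟩
    exact absurd (le_csSup hSbdd hyS) (not_le.mpr hy)
  have hφc : φ c = 0 := by
    refine le_antisymm hφc_le ?_
    have htc : Tendsto φ (𝓝[>] c) (𝓝 (φ c)) := (hφ c).continuousAt.continuousWithinAt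
    refine ge_of_tendsto htc ?_
    filter_upwards [Ioo_mem_nhdsGT hcβ] with y hy using (hafter y hy.1 hy.2.le).le
  have hαc : α < c := lt_of_le_of_ne hcS.1.1 fun h => by
    rw [← h] at hφc
    exact absurd hφc hα.ne
  have htend' : Tendsto (slope φ c) (𝓝[>] c) (𝓝 (deriv φ c)) :=
    (hasDerivAt_iff_tendsto_slope.mp (hφ c).hasDerivAt).mono_left
      (nhdsWithin_mono _ fun x hx => ne_of_gt hx)
  have hge : 0 ≤ deriv φ c := by
    refine ge_of_tendsto htend' ?_
    filter_upwards [Ioo_mem_nhdsGT hcβ] with y hy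
    rw [slope_def_field, hφc, sub_zero]
    exact (div_pos (hafter y hy.1 hy.2.le) (sub_pos.mpr hy.1)).le
  exact ⟨c, ⟨hαc, hcβ⟩, hφc, hge⟩

/-- (H1⁺) real dimple core: `g` twice differentiable, zero-free on `[α, β]`, `g·g′ < 0` at `α` and `> 0` at `β` ⟹ some `c ∈ (α, β)` has
`g′ c = 0`, `g c ≠ 0`, `0 ≤ g c · g″ c`. -/
theorem exists_nl_of_dimple {g : ℝ → ℝ} (hg : Differentiable ℝ g) (hg' : Differentiable ℝ (deriv g))
    {α β : ℝ} (hlt : α < β) (hα : g α * deriv g α < 0) (hβ : 0 < g β * deriv g β)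
    (hnz : ∀ x ∈ Icc α β, g x ≠ 0) :
    ∃ c ∈ Ioo α β, deriv g c = 0 ∧ g c ≠ 0 ∧ 0 ≤ g c * deriv (deriv g) c := by
  set φ : ℝ → ℝ := fun x => g x * deriv g x with hφ
  have hφd : Differentiable ℝ φ := hg.mul hg'
  have hφ' : ∀ x, deriv φ x = deriv g x * deriv g x + g x * deriv (deriv g) x := fun x => by
    rw [hφ]
    change deriv (g * deriv g) x = _
    rw [deriv_mul (hg x) (hg' x)]
  obtain ⟨c, hc, hφc, hge⟩ := exists_zero_deriv_nonneg_of_lt hφd hlt hα hβ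
  have hgc : g c ≠ 0 := hnz c ⟨hc.1.le, hc.2.le⟩
  have hdc : deriv g c = 0 := by
    have h0 : g c * deriv g c = 0 := hφc
    rcases mul_eq_zero.mp h0 with h | h
    · exact absurd h hgc
    · exact h
  refine ⟨c, hc, hdc, hgc, ?_⟩
  have h := hge
  rw [hφ' c, hdc, mul_zero, zero_add] at h
  exact h

/-- ★★★ (K) DIMPLE LEMMA (complex / iterated-derivative form = the tree's `NLEventOf`): `f` entire, `f^{(k)}` real on ℝ and zero-free on `[α, β]`,
`Re f^{(k+1)}·Re f^{(k)} < 0` at `α` and `> 0` at `β` ⟹ `NLEventOf f k c` for some `c ∈ (α, β)`. With `α = a − b`, `β = a + b` for a pair `a + ib` of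
`f^{(k)}` whose shadow is tooth-free: `Γ(a − b) < 1/b ∧ Γ(a + b) > −1/b ⟹` an NL-event under the pair at level `k` (`TiltReady` if `|c − x₀| < (k+3)R/2`).
Contrapositive = the NEG constraint: on a refuting frame every in-range pair with tooth-free shadow, at every level `≤ K`, has `Γ(a − b) ≥ 1/b` or
`Γ(a + b) ≤ −1/b`. -/
theorem nlEventOf_of_dimple {f : ℂ → ℂ} (hf : Differentiable ℂ f) (k : ℕ)
    (hreal : ∀ x : ℝ, (iteratedDeriv k f (x : ℂ)).im = 0)
    {α β : ℝ} (hlt : α < β) (hnz : ∀ x ∈ Icc α β, iteratedDeriv k f (x : ℂ) ≠ 0)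
    (hα : (iteratedDeriv (k + 1) f (α : ℂ)).re * (iteratedDeriv k f (α : ℂ)).re < 0)
    (hβ : 0 < (iteratedDeriv (k + 1) f (β : ℂ)).re * (iteratedDeriv k f (β : ℂ)).re) :
    ∃ c ∈ Ioo α β, NLEventOf f k c := by
  have hdk : ∀ n : ℕ, Differentiable ℂ (iteratedDeriv n f) := fun n =>
    (hf.contDiff (n := ⊤)).differentiable_iteratedDeriv n (WithTop.coe_lt_top _)
  set g : ℝ → ℝ := fun t => (iteratedDeriv k f (t : ℂ)).re with hgdef
  have hg1 : ∀ t : ℝ, HasDerivAt g ((iteratedDeriv (k + 1) f (t : ℂ)).re) t := fun t =>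
    hasDerivAt_re_iteratedDeriv hf k t
  have hderiv_g : deriv g = fun t : ℝ => (iteratedDeriv (k + 1) f (t : ℂ)).re := funext fun t => (hg1 t).deriv
  have hg2 : ∀ t : ℝ, HasDerivAt (deriv g) ((iteratedDeriv (k + 2) f (t : ℂ)).re) t := fun t => by
    rw [hderiv_g]
    exact hasDerivAt_re_iteratedDeriv hf (k + 1) t
  have hgd : Differentiable ℝ g := fun t => (hg1 t).differentiableAt
  have hgd' : Differentiable ℝ (deriv g) := fun t => (hg2 t).differentiableAt
  have hdd : deriv (deriv g) = fun t : ℝ => (iteratedDeriv (k + 2) f (t : ℂ)).re := funext fun t => (hg2 t).deriv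
  have hnz' : ∀ x ∈ Icc α β, g x ≠ 0 := fun x hx => RhW08.WindowLoss.re_ne_zero_of_ne_zero (hreal x) (hnz x hx)
  have hα' : g α * deriv g α < 0 := by rw [hderiv_g, mul_comm]; exact hα
  have hβ' : 0 < g β * deriv g β := by rw [hderiv_g, mul_comm]; exact hβ
  obtain ⟨c, hc, hdc, hgc, hnl⟩ := exists_nl_of_dimple hgd hgd' hlt hα' hβ' hnz'
  refine ⟨c, hc, ?_, hgc, ?_⟩
  · rw [hderiv_g] at hdc
    exact hdc
  · rw [hdd] at hnl
    exact hnl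

/-- (K) … inside the LAW's range the dimple is a `TiltReady` witness at level `k` (state-free: any `u`). -/
theorem tiltReady_of_dimple {f : ℂ → ℂ} (hf : Differentiable ℂ f) (η x₀ s hmax R Hs : ℝ) (B k : ℕ) (u : ℂ)
    (hreal : ∀ x : ℝ, (iteratedDeriv k f (x : ℂ)).im = 0)
    {α β : ℝ} (hlt : α < β) (hrα : |α - x₀| < ((k : ℝ) + 3) * R / 2) (hrβ : |β - x₀| < ((k : ℝ) + 3) * R / 2)
    (hnz : ∀ x ∈ Icc α β, iteratedDeriv k f (x : ℂ) ≠ 0)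
    (hα : (iteratedDeriv (k + 1) f (α : ℂ)).re * (iteratedDeriv k f (α : ℂ)).re < 0)
    (hβ : 0 < (iteratedDeriv (k + 1) f (β : ℂ)).re * (iteratedDeriv k f (β : ℂ)).re) :
    TiltReady η f x₀ s hmax R Hs B k u := by
  obtain ⟨c, hc, hnl⟩ := nlEventOf_of_dimple hf k hreal hlt hnz hα hβ
  refine ⟨c, ?_, hnl⟩
  rw [abs_sub_lt_iff] at hrα hrβ ⊢
  constructor <;> linarith [hc.1, hc.2]

/-- ★ (K) … hence `ReadyR2` at level `k` (every state) — the form that CONTRADICTS the `¬ ReadyR2` hypothesis of a charged level in `stub_restSuccBotQ`: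
a pre-Ready level has NO shadow-free weak-edge pair within the range (this is the rigorous half of residual (B2) of the (CA356) plan that C3 can supply). -/
theorem readyR2_of_dimple {f : ℂ → ℂ} (hf : Differentiable ℂ f) (η x₀ s hmax R Hs : ℝ) (B k : ℕ) (u : ℂ)
    (hreal : ∀ x : ℝ, (iteratedDeriv k f (x : ℂ)).im = 0)
    {α β : ℝ} (hlt : α < β) (hrα : |α - x₀| < ((k : ℝ) + 3) * R / 2) (hrβ : |β - x₀| < ((k : ℝ) + 3) * R / 2)
    (hnz : ∀ x ∈ Icc α β, iteratedDeriv k f (x : ℂ) ≠ 0)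
    (hα : (iteratedDeriv (k + 1) f (α : ℂ)).re * (iteratedDeriv k f (α : ℂ)).re < 0)
    (hβ : 0 < (iteratedDeriv (k + 1) f (β : ℂ)).re * (iteratedDeriv k f (β : ℂ)).re) :
    ReadyR2 η f x₀ s hmax R Hs B k u :=
  ⟨k, le_rfl, Or.inr (tiltReady_of_dimple hf η x₀ s hmax R Hs B k u hreal hlt hrα hrβ hnz hα hβ)⟩

/-- (K) the pair term of the real log-derivative: `2(x − a)/((x − a)² + b²)` equals `1/b` at `x = a + b` and `−1/b` at `x = a − b`
(so `|Γ(a ± b)| < 1/b` produces the signs `∓` of `F_{k+1}/F_k` at `a ∓ b` — the weak-field reading of the three-sign lemma). -/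
theorem pair_term_at_edges (a b : ℝ) (hb : 0 < b) :
    2 * ((a + b) - a) / (((a + b) - a) ^ 2 + b ^ 2) = 1 / b ∧ 2 * ((a - b) - a) / (((a - b) - a) ^ 2 + b ^ 2) = -(1 / b) := by
  have hb0 : b ≠ 0 := hb.ne'
  constructor
  · field_simp; ring
  · field_simp; ring

/-- (K) … and it is bounded by `1/b` in absolute value everywhere on the real axis (AM–GM), decaying like `2/|x − a|`:
the external field `Γ` wins wherever `|Γ(x)| > 2/|x − a|`. -/
theorem pair_term_abs_le (a b x : ℝ) (hb : 0 < b) :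
    |2 * (x - a) / ((x - a) ^ 2 + b ^ 2)| ≤ 1 / b := by
  have hden : 0 < (x - a) ^ 2 + b ^ 2 := by positivity
  rw [abs_div, abs_of_pos hden, div_le_div_iff₀ hden hb, one_mul]
  have h2 : |2 * (x - a)| = 2 * |x - a| := by rw [abs_mul, abs_two]
  rw [h2]
  nlinarith [sq_abs (x - a), sq_nonneg (|x - a| - b), abs_nonneg (x - a)]

section StateGlue

open RhIdea5.G17.W07C9.Helpers RhW08.QuadW

/-- ★★ (K) STATE-LEVEL GLUE for the hand (`stub_restSuccBotQ`, `case neg`): on an `EngineHyps5 2`-frame, a level-`k` BAND state `v` (`StTrkDQ … k v`) whose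
real shadow `[v.re − v.im, v.re + v.im]` is free of zeros of `f⁽ᵏ⁾` and whose two edge products `Re f⁽ᵏ⁺¹⁾ · Re f⁽ᵏ⁾` are `< 0` (left) and `> 0` (right) — the
WEAK-FIELD pair of the memo (`Γ(a − b) < 1/b ∧ Γ(a + b) > −1/b`) — makes level `k` `ReadyR2` (for every state `u`): the shadow lies inside the LAW's range by the
tree's `abs_re_sub_le_of_stTrkDQ` + `band_radius_lt_range'`, realness of `f⁽ᵏ⁾` on `ℝ` by `Literature.Analysis.Complex.im_iteratedDeriv_ofReal`. Contradicts `¬ ReadyR2 … k v`. -/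
theorem readyR2_of_dimple_state {η : ℝ} {f : ℂ → ℂ} {x₀ s hmax R Hs : ℝ} {B : ℕ} (hE : EngineHyps5 2 η f x₀ s hmax R Hs B)
    (k : ℕ) (u : ℂ) {v : ℂ} (hv : StTrkDQ η f x₀ s hmax R Hs B k v)
    (hnz : ∀ x ∈ Icc (v.re - v.im) (v.re + v.im), iteratedDeriv k f (x : ℂ) ≠ 0)
    (hα : (iteratedDeriv (k + 1) f ((v.re - v.im : ℝ) : ℂ)).re * (iteratedDeriv k f ((v.re - v.im : ℝ) : ℂ)).re < 0)
    (hβ : 0 < (iteratedDeriv (k + 1) f ((v.re + v.im : ℝ) : ℂ)).re * (iteratedDeriv k f ((v.re + v.im : ℝ) : ℂ)).re) :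
    ReadyR2 η f x₀ s hmax R Hs B k u := by
  obtain ⟨hf, hreal, _, hs, hCs, hChm, h3, hHs, _, hCHs, _⟩ := hE
  have hR0 : 0 < R := by linarith
  have hvim : 0 < v.im := hv.2.2.1
  have hvHs : v.im ≤ Hs := hv.2.2.2.2
  have h1 : |v.re - x₀| ≤ R / 2 + Real.sqrt k * Hs := abs_re_sub_le_of_stTrkDQ hHs hv
  have h2 : R / 2 + Real.sqrt k * Hs + Hs < ((k : ℝ) + 3) * R / 2 := band_radius_lt_range' hHs hCHs hR0 k
  rw [abs_le] at h1
  have hrα : |(v.re - v.im) - x₀| < ((k : ℝ) + 3) * R / 2 := by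
    rw [abs_lt]; constructor <;> linarith
  have hrβ : |(v.re + v.im) - x₀| < ((k : ℝ) + 3) * R / 2 := by
    rw [abs_lt]; constructor <;> linarith
  exact readyR2_of_dimple hf η x₀ s hmax R Hs B k u (Literature.Analysis.Complex.im_iteratedDeriv_ofReal hf hreal k)
    (by linarith) hrα hrβ hnz hα hβ

end StateGlue

end RhIdea3.G35.Landing
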